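import Literature.MathematicalPhysics.QuantumFieldTheory.Balaban1983to89.B14Eq329Family

/-!
# `Balaban1983to89.B14.Eq328Printed` — T. Bałaban, *Convergent renormalization expansions for lattice gauge theories*,
# Commun. Math. Phys. **119** (1988) 243–285 [Balaban1988Convergent] = [III]: (3.28) pp. 271–272 — THE EXPANSION IN THE
# EXTERNAL FLUCTUATION FIELD `A_k`, BOTH PRINTED EQUALITIES OF (3.28) END TO END, for GENUINE finite-dimensional Gaussian
# integrals (the (3.29) family of file 1 `B14.Eq329Family`), on top of p27's `B14.InterpolationMeasure` (the dominated
# interchange, gen 2) and r11's `B14.Eq328GaussianIBP` (the tilted Gaussian integration by parts) — file 2 of 2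

statement-level skeleton of published theorems with citation tags; proofs where landed; nothing here is a claim
about the Yang–Mills mass gap

CITATION HEADER (lean-in-tree rule).  T. Bałaban, *Convergent renormalization expansions for lattice gauge theories*,
Commun. Math. Phys. **119**, 243–285 (1988), doi:10.1007/BF01217741, bib `Balaban1988Convergent` (cell paper B14 = "[III]";
PDF held `paper:balaban1988-cmp119-convergent-renormalization`, journal page = PDF page + 242; (3.28)–(3.29) RE-READ for this
file on the x2 renders `…-p029-x2.png` / `…-p030-x2.png` of `run/shared/lean/pub/pub-balaban/b2b-balaban-ref1/pages/
1988-cmp119-convergent-renormalization/`).  Mega-formalization `lit-balaban` (HOME `run/shared/lean/pub/lit-balaban/`), Phase-2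
proof seat **p27 gen 91** (free target, protocol G.5-34 (d), TAKING line HOME/STATUS 2026-08-26T01:13Z; B14 fold owner r11);
SKELETON row **B14.Eq3.28–3.29** (cells only; decls of record `B14.Interpolation.Eq330` and r11's `B14.Eq328GaussianIBP.*`
untouched).  Classical tools: Glimm–Jaffe, *Quantum Physics* (1987) §9.1 (9.1.27), (9.1.28), (9.1.32) [GlimmJaffe1987], by name.

THE PRINT (pp. 271–272 [PDF 29–30], verbatim from the renders).  *"At first we separate obvious boundary terms connected with
the external fluctuation field A_k, by expanding in this field. We introduce the parameter t multiplying A_k in the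
expressions in the logarithm. We have
  log[z^{(k)} ∫ dA χ^{(k)} exp[−½⟨A, C*Δ^{(k)}CA⟩ − ….(s = 0, t = 0)….]]
  = ∫₀¹ dt ⟨ −⟨A, C*Δ^{(k)}CA_k⟩ + ⟨(δ/δtA_k) 𝐏^{(k)}(g_k, (tA_k, A)), A_k⟩ + ⟨(δ/δtA_k) 𝐄_k(U_k(….)), A_k⟩ ⟩_t
    − ½⟨A_k, C*Δ^{(k)}CC^{(k)}(Λ_{k+1})C*Δ^{(k)}CA_k⟩ + log[z^{(k)} ∫ dA χ^{(k)} exp[−½⟨A, C*Δ^{(k)}CA⟩ − ….(s = 0, t = 0, A_k = 0)….]]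
  = ∫₀¹ dt ⟨ −⟨A_k, C*Δ^{(k)}CC^{(k)}(Λ_{k+1})((δ/δA)χ^{(k)} + (δ/δA)𝐏^{(k)}(g_k, (tA_k, A)) + (δ/δA)𝐄_k(U_k(….)))⟩
    + ⟨(δ/δtA_k) 𝐏^{(k)}(g_k, (tA_k, A)), A_k⟩ + ⟨(δ/δtA_k) 𝐄_k(U_k(…)), A_k⟩ ⟩_t
    + log[z^{(k)} ∫ dA χ^{(k)} exp[−½⟨A, C*Δ^{(k)}CA⟩ + 𝐏^{(k)}(g_k, A) + {𝐄_k(U_k(exp i[g_kCA − hD̃(g_kCA)]V^{(k)})) − 𝐄_k(U_{k+1})}]].  (3.28)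
  Here ⟨·⟩_t denotes the expectation value with respect to the probabilistic measure
  Z_t^{−1} dμ_{C^{(k)}(Λ_{k+1})}(A) χ^{(k)} exp[−t⟨A, C*Δ^{(k)}CA_k⟩ + 𝐏^{(k)}(g_k, (tA_k, A)) + {𝐄_k(U_k(…(tA_k, A)…)) − 𝐄_k(U_{k+1})}].  (3.29)"*

READING: as in file 1 `B14.Eq329Family` (module docstring) and r11's `B14.Eq328GaussianIBP` — `A = v ∈ ι → ℝ`, `dμ_C(v) ∝
e^{−½vᵀC⁻¹v}dv` with `C := C^{(k)}(Λ_{k+1})` positive definite, `A_k = a ∈ κ → ℝ`, `w₀ := C*Δ^{(k)}CA_k` (so `⟨A, C*Δ^{(k)}CA_k⟩ =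
⟨v,w₀⟩` and `⟨A_k, C*Δ^{(k)}C C (δ/δA)F⟩ = ∂_{Cw₀}F`), `χ := χ^{(k)}`, `𝐏(a′,v)`, `𝐄(a′,v)`, `𝐄₁ := 𝐄_k(U_{k+1})`, `a′ = t•a`; the
left-hand side's *"….(s = 0, t = 0)…."* is the (3.29) exponent at `t = 1` plus the `A_k`-quadratic constant `−½⟨w₀, Cw₀⟩` of (3.25).

WHAT THIS FILE PROVES (kernel-checked, zero `sorry`; THEOREMS ONLY — no `def`, no new `Prop`, no named fact; axioms standard),
for `C` positive definite, `w₀`, `a` arbitrary, `χ ∈ C¹(ι → ℝ)`, `χ ≥ 0`, compactly supported, `≢ 0`, `𝐏, 𝐄 ∈ C¹` jointly; the (3.29)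
family of file 1 (`w = χ·e^{−½vᵀC⁻¹v}`, `S_t(v) = −t⟨v,w₀⟩ + 𝐏(t•a,v) + {𝐄(t•a,v) − 𝐄₁}`, `Z_t = partFn volume w S t`, `⟨G⟩_t =
gibbsExpect volume w S G t`; file 1 supplies `partFn_pos`, `domFamily`, `eq328_ftc` = the first equality in Gibbs form):
* §3 **`gibbsExpect_neg_dotProduct`** — r11's `eq328_linear_term` at the weight `H_t`, normalised:
  `⟨−⟨·,w₀⟩⟩_t = t⟨w₀, Cw₀⟩ − ⟨∂_{Cw₀}χ/χ + ∂_{Cw₀}𝐏(t•a,·) + ∂_{Cw₀}𝐄(t•a,·)⟩_t`;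
* §4 **(3.28)**: `eq328_lhs` (the left-hand side is `log Z_1 − ½⟨w₀,Cw₀⟩`), `partFn_zero_eq` (the last logarithm), **`eq328_first`**
  (the first printed equality), `gibbsExpect_S'_eq` / `integral_gibbsExpect_S'_eq` (the per-`t` identity and `∫₀¹ t dt = ½`,
  r11's `eq328_half`, CANCELLING `−½⟨w₀,Cw₀⟩`), **`eq328_second`** (the second printed equality) and **`eq328`** (left-hand side =
  last member), all inserts written out as print has them;
* §5 (v1.1) **(3.29) itself**: `isProbabilityMeasure_gibbsLaw` (the tilted law `Z_t⁻¹·(χ e^{S_t} dμ_C)` is a PROBABILITY MEASURE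
  for every `t`) and `integral_gibbsLaw` (`⟨G⟩_t = gibbsExpect volume w S G t` IS the expectation of `G` in that measure).
HONEST SCOPE / DIVERGENCES.  (1) Print's `χ^{(k)}` is a sharp characteristic function and *"(δ/δA)χ^{(k)}"* is formal; here `χ` is
a `C¹` cut-off `≥ 0` of compact support and *"(δ/δA)χ"* inside `⟨·⟩_t` reads `∂χ/χ` (legitimate: `∂χ = 0` on `{χ = 0}`,
`fderiv_div_mul_self`) — r11's scope note (i) of `B14.Eq328GaussianIBP`, unchanged.  (2) `𝐏`, `𝐄` are assumed `C¹` on the whole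
product space (print: analytic near the domain cut out by `χ^{(k)}`, (2.19)–(2.23)).  (3) The identification with Bałaban's
operators is the READING; nothing about which terms *"contribute to 𝐁^{(k+1)} only"*.  NOT summit progress.  p27 gen 91, 2026-08-26.
-/

noncomputable section

open MeasureTheory Matrix Real Filter Topology Set
open scoped Matrix BigOperators

namespace Literature.MathematicalPhysics.QuantumFieldTheory.Balaban1983to89.B14.Eq328Printed

open B14.InterpolationMeasure B14.Eq328GaussianIBP B14.Eq329Family

variable {ι κ : Type*} [Fintype ι] [Fintype κ]

section Family

variable [DecidableEq ι]
variable (C : Matrix ι ι ℝ) (w₀ : ι → ℝ) (a : κ → ℝ) {χ : (ι → ℝ) → ℝ} {P E : (κ → ℝ) → (ι → ℝ) → ℝ} (E₁ : ℝ)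

/-! ## §3  The second equality per `t`: r11's tilted Gaussian integration by parts at the weight `H_t` -/

/-- **Un-normalised Gaussian integration by parts for the (3.29) family** — r11's `eq328_linear_term` (Glimm–Jaffe (9.1.32)) at
`H_t = χ·exp[𝐏(t•a,·) + {𝐄(t•a,·) − 𝐄₁}]` (`C¹`, compact support), `∂_{Cw₀}H_t = (∂_{Cw₀}χ/χ + ∂_{Cw₀}𝐏 + ∂_{Cw₀}𝐄)·H_t` pointwise:
`∫ (−⟨v,w₀⟩) w e^{S_t} = t⟨w₀,Cw₀⟩·Z_t − ∫ (∂_{Cw₀}χ/χ + ∂_{Cw₀}𝐏 + ∂_{Cw₀}𝐄) w e^{S_t}`.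
[cite: Balaban1988Convergent, (3.28)–(3.29) p.272] [cite: GlimmJaffe1987, §9.1 (9.1.32)] -/
theorem gibbsNum_neg_dotProduct (hC : C.PosDef) (hχ : ContDiff ℝ 1 χ) (hχs : HasCompactSupport χ)
    (hχ0 : ∀ v, 0 ≤ χ v) (hP : ContDiff ℝ 1 (Function.uncurry P)) (hE : ContDiff ℝ 1 (Function.uncurry E))
    {w : (ι → ℝ) → ℝ} {S D : ℝ → (ι → ℝ) → ℝ}
    (hw : w = fun v => χ v * Real.exp (-(1/2 : ℝ) * (v ⬝ᵥ C⁻¹ *ᵥ v)))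
    (hS : S = fun t v => -(t * (v ⬝ᵥ w₀)) + (P (t • a) v + (E (t • a) v - E₁)))
    (hD : D = fun t v => fderiv ℝ χ v (C *ᵥ w₀) / χ v
      + (fderiv ℝ (fun v' => P (t • a) v') v (C *ᵥ w₀) + fderiv ℝ (fun v' => E (t • a) v') v (C *ᵥ w₀))) (t : ℝ) :
    gibbsNum volume w S (fun v => -(v ⬝ᵥ w₀)) t
      = t * (w₀ ⬝ᵥ C *ᵥ w₀) * partFn volume w S t - gibbsNum volume w S (D t) t := by
  set H : (ι → ℝ) → ℝ := fun v => χ v * Real.exp (P (t • a) v + (E (t • a) v - E₁)) with hH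
  have hHd : ContDiff ℝ 1 H := weight_contDiff hχ hP hE (t • a) E₁
  have hHs : HasCompactSupport H := hχs.mul_right
  obtain ⟨K₀, hK₀⟩ := hHd.continuous.bounded_above_of_compact_support hHs
  obtain ⟨K₁, hK₁⟩ := (hHd.continuous_fderiv one_ne_zero).bounded_above_of_compact_support (hHs.fderiv (𝕜 := ℝ))
  have key := eq328_linear_term C hC hHd hK₀ hK₁ w₀ t
  have e1 : gibbsNum volume w S (fun v => -(v ⬝ᵥ w₀)) t = ∫ v : ι → ℝ, -(v ⬝ᵥ w₀)
      * (Real.exp (-(t * (v ⬝ᵥ w₀))) * H v) * Real.exp (-(1/2 : ℝ) * (v ⬝ᵥ C⁻¹ *ᵥ v)) := by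
    unfold gibbsNum
    refine integral_congr_ae (ae_of_all _ fun v => ?_)
    simp only [gibbsWeight_eq C w₀ a E₁ hw hS t v, hH]; ring
  have e2 : partFn volume w S t = ∫ v : ι → ℝ,
      Real.exp (-(t * (v ⬝ᵥ w₀))) * H v * Real.exp (-(1/2 : ℝ) * (v ⬝ᵥ C⁻¹ *ᵥ v)) := by
    unfold partFn
    refine integral_congr_ae (ae_of_all _ fun v => ?_)
    simp only [gibbsWeight_eq C w₀ a E₁ hw hS t v, hH]
  have e3 : gibbsNum volume w S (D t) t = ∫ v : ι → ℝ,
      Real.exp (-(t * (v ⬝ᵥ w₀))) * fderiv ℝ H v (C *ᵥ w₀) * Real.exp (-(1/2 : ℝ) * (v ⬝ᵥ C⁻¹ *ᵥ v)) := by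
    unfold gibbsNum
    refine integral_congr_ae (ae_of_all _ fun v => ?_)
    simp only [hH, hD]
    rw [fderiv_weight_apply hχ hP hE (t • a) E₁ v (C *ᵥ w₀), gibbsWeight_eq C w₀ a E₁ hw hS t v]
    linear_combination (Real.exp (-(t * (v ⬝ᵥ w₀))) * Real.exp (P (t • a) v + (E (t • a) v - E₁))
      * Real.exp (-(1/2 : ℝ) * (v ⬝ᵥ C⁻¹ *ᵥ v))) * fderiv_div_mul_self hχ0 v (C *ᵥ w₀)
  rw [e1, key, e2, e3]

/-- **(3.28), THE SECOND EQUALITY PER `t`, NORMALISED** (divide by `Z_t > 0`): `⟨−⟨A, C*Δ^{(k)}CA_k⟩⟩_t = t⟨A_k, C*Δ^{(k)}C C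
C*Δ^{(k)}CA_k⟩ − ⟨⟨A_k, C*Δ^{(k)}CC((δ/δA)χ^{(k)} + (δ/δA)𝐏^{(k)} + (δ/δA)𝐄_k)⟩⟩_t`, i.e. `⟨−⟨·,w₀⟩⟩_t = t⟨w₀,Cw₀⟩ − ⟨D_t⟩_t`.
[cite: Balaban1988Convergent, (3.28)–(3.29) p.272] [cite: GlimmJaffe1987, §9.1 (9.1.32)] -/
theorem gibbsExpect_neg_dotProduct (hC : C.PosDef) (hχ : ContDiff ℝ 1 χ) (hχs : HasCompactSupport χ)
    (hχ0 : ∀ v, 0 ≤ χ v) (hχne : ∃ v, χ v ≠ 0) (hP : ContDiff ℝ 1 (Function.uncurry P))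
    (hE : ContDiff ℝ 1 (Function.uncurry E)) {w : (ι → ℝ) → ℝ} {S D : ℝ → (ι → ℝ) → ℝ}
    (hw : w = fun v => χ v * Real.exp (-(1/2 : ℝ) * (v ⬝ᵥ C⁻¹ *ᵥ v)))
    (hS : S = fun t v => -(t * (v ⬝ᵥ w₀)) + (P (t • a) v + (E (t • a) v - E₁)))
    (hD : D = fun t v => fderiv ℝ χ v (C *ᵥ w₀) / χ v
      + (fderiv ℝ (fun v' => P (t • a) v') v (C *ᵥ w₀) + fderiv ℝ (fun v' => E (t • a) v') v (C *ᵥ w₀))) (t : ℝ) :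
    gibbsExpect volume w S (fun v => -(v ⬝ᵥ w₀)) t = t * (w₀ ⬝ᵥ C *ᵥ w₀) - gibbsExpect volume w S (D t) t := by
  have hZ := (partFn_pos C w₀ a E₁ hχ hχs hχ0 hχne hP hE hw hS t).ne'
  unfold gibbsExpect
  rw [gibbsNum_neg_dotProduct C w₀ a E₁ hC hχ hχs hχ0 hP hE hw hS hD t]
  field_simp

/-! ## §4  (3.28) assembled: the left-hand side, the first printed equality, the cancellation `∫₀¹ t dt = ½`, the second
printed equality -/
/-- **The left-hand side of (3.28)**: the logarithm with the full *"….(s = 0, t = 0)…."* exponent — the (3.29) exponent at `t = 1`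
together with the `A_k`-quadratic constant `−½⟨A_k, C*Δ^{(k)}CC^{(k)}(Λ_{k+1})C*Δ^{(k)}CA_k⟩ = −½⟨w₀,Cw₀⟩` — equals
`log Z_1 − ½⟨w₀, Cw₀⟩`. [cite: Balaban1988Convergent, (3.28) p.271] -/
theorem eq328_lhs (hχ : ContDiff ℝ 1 χ) (hχs : HasCompactSupport χ) (hχ0 : ∀ v, 0 ≤ χ v) (hχne : ∃ v, χ v ≠ 0)
    (hP : ContDiff ℝ 1 (Function.uncurry P)) (hE : ContDiff ℝ 1 (Function.uncurry E))
    {w : (ι → ℝ) → ℝ} {S : ℝ → (ι → ℝ) → ℝ}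
    (hw : w = fun v => χ v * Real.exp (-(1/2 : ℝ) * (v ⬝ᵥ C⁻¹ *ᵥ v)))
    (hS : S = fun t v => -(t * (v ⬝ᵥ w₀)) + (P (t • a) v + (E (t • a) v - E₁))) :
    Real.log (∫ v : ι → ℝ, χ v * Real.exp (-(v ⬝ᵥ w₀) - (1/2 : ℝ) * (w₀ ⬝ᵥ C *ᵥ w₀) + (P a v + (E a v - E₁)))
        * Real.exp (-(1/2 : ℝ) * (v ⬝ᵥ C⁻¹ *ᵥ v)))
      = Real.log (partFn volume w S 1) - (1/2 : ℝ) * (w₀ ⬝ᵥ C *ᵥ w₀) := by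
  have hZ := partFn_pos C w₀ a E₁ hχ hχs hχ0 hχne hP hE hw hS 1
  have h1 : (∫ v : ι → ℝ, χ v * Real.exp (-(v ⬝ᵥ w₀) - (1/2 : ℝ) * (w₀ ⬝ᵥ C *ᵥ w₀) + (P a v + (E a v - E₁)))
        * Real.exp (-(1/2 : ℝ) * (v ⬝ᵥ C⁻¹ *ᵥ v)))
      = Real.exp (-((1/2 : ℝ) * (w₀ ⬝ᵥ C *ᵥ w₀))) * partFn volume w S 1 := by
    unfold partFn
    rw [← MeasureTheory.integral_const_mul]
    refine integral_congr_ae (ae_of_all _ fun v => ?_)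
    simp only [gibbsWeight, hw, hS, one_smul, one_mul]
    rw [show -(v ⬝ᵥ w₀) - (1/2 : ℝ) * (w₀ ⬝ᵥ C *ᵥ w₀) + (P a v + (E a v - E₁))
        = -((1/2 : ℝ) * (w₀ ⬝ᵥ C *ᵥ w₀)) + (-(v ⬝ᵥ w₀) + (P a v + (E a v - E₁))) by ring, Real.exp_add]
    ring
  rw [h1, Real.log_mul (Real.exp_pos _).ne' hZ.ne', Real.log_exp]
  ring

omit [Fintype κ] in
/-- **The last logarithm of (3.28)**: `Z_0` is the integral with `A_k = 0` —
`log[z^{(k)}∫dAχ^{(k)} exp[−½⟨A, C*Δ^{(k)}CA⟩ + 𝐏^{(k)}(g_k, A) + {𝐄_k(U_k(…)) − 𝐄_k(U_{k+1})}]]`, no linear term.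
[cite: Balaban1988Convergent, (3.28) p.272] -/
theorem partFn_zero_eq {w : (ι → ℝ) → ℝ} {S : ℝ → (ι → ℝ) → ℝ}
    (hw : w = fun v => χ v * Real.exp (-(1/2 : ℝ) * (v ⬝ᵥ C⁻¹ *ᵥ v)))
    (hS : S = fun t v => -(t * (v ⬝ᵥ w₀)) + (P (t • a) v + (E (t • a) v - E₁))) :
    partFn volume w S 0
      = ∫ v : ι → ℝ, χ v * Real.exp (P 0 v + (E 0 v - E₁)) * Real.exp (-(1/2 : ℝ) * (v ⬝ᵥ C⁻¹ *ᵥ v)) := by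
  unfold partFn
  refine integral_congr_ae (ae_of_all _ fun v => ?_)
  simp only [gibbsWeight, hw, hS, zero_smul, zero_mul, neg_zero, zero_add]
  ring

/-- **(3.28), THE FIRST PRINTED EQUALITY, for genuine Gaussian integrals**:
`log[∫ χ exp[−⟨A,w₀⟩ − ½⟨w₀,Cw₀⟩ + 𝐏(A_k,A) + {𝐄(A_k,A) − 𝐄₁}] dμ_C]
   = ∫₀¹ dt ⟨−⟨A,w₀⟩ + ⟨(δ/δtA_k)𝐏(tA_k,A), A_k⟩ + ⟨(δ/δtA_k)𝐄(tA_k,A), A_k⟩⟩_t − ½⟨w₀,Cw₀⟩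
     + log[∫ χ exp[𝐏(0,A) + {𝐄(0,A) − 𝐄₁}] dμ_C]`
— `eq328_ftc` (FTC + dominated interchange + chain rule in `tA_k`) + `eq328_lhs`. [cite: Balaban1988Convergent, (3.28) pp.271–272] -/
theorem eq328_first (hχ : ContDiff ℝ 1 χ) (hχs : HasCompactSupport χ) (hχ0 : ∀ v, 0 ≤ χ v) (hχne : ∃ v, χ v ≠ 0)
    (hP : ContDiff ℝ 1 (Function.uncurry P)) (hE : ContDiff ℝ 1 (Function.uncurry E))
    {w : (ι → ℝ) → ℝ} {S S' : ℝ → (ι → ℝ) → ℝ}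
    (hw : w = fun v => χ v * Real.exp (-(1/2 : ℝ) * (v ⬝ᵥ C⁻¹ *ᵥ v)))
    (hS : S = fun t v => -(t * (v ⬝ᵥ w₀)) + (P (t • a) v + (E (t • a) v - E₁)))
    (hS' : S' = fun t v => -(v ⬝ᵥ w₀) + (fderiv ℝ (fun a' => P a' v) (t • a) a + fderiv ℝ (fun a' => E a' v) (t • a) a)) :
    Real.log (∫ v : ι → ℝ, χ v * Real.exp (-(v ⬝ᵥ w₀) - (1/2 : ℝ) * (w₀ ⬝ᵥ C *ᵥ w₀) + (P a v + (E a v - E₁)))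
        * Real.exp (-(1/2 : ℝ) * (v ⬝ᵥ C⁻¹ *ᵥ v)))
      = (∫ t in (0:ℝ)..1, gibbsExpect volume w S (S' t) t) - (1/2 : ℝ) * (w₀ ⬝ᵥ C *ᵥ w₀)
        + Real.log (∫ v : ι → ℝ, χ v * Real.exp (P 0 v + (E 0 v - E₁)) * Real.exp (-(1/2 : ℝ) * (v ⬝ᵥ C⁻¹ *ᵥ v))) := by
  rw [eq328_lhs C w₀ a E₁ hχ hχs hχ0 hχne hP hE hw hS, eq328_ftc C w₀ a E₁ hχ hχs hχ0 hχne hP hE hw hS hS',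
    partFn_zero_eq C w₀ a E₁ hw hS]
  ring

/-- The insert `v ↦ (∂_{Cw₀}χ/χ + ∂_{Cw₀}𝐏 + ∂_{Cw₀}𝐄)(v)` against the weight is integrable: pointwise it is the continuous,
compactly supported `e^{−t⟨v,w₀⟩}(∂_{Cw₀}H_t)(v)e^{−½vᵀC⁻¹v}`. [cite: Balaban1988Convergent, (3.28) p.272] -/
theorem integrable_D_mul_gibbsWeight (hχ : ContDiff ℝ 1 χ) (hχs : HasCompactSupport χ) (hχ0 : ∀ v, 0 ≤ χ v)
    (hP : ContDiff ℝ 1 (Function.uncurry P)) (hE : ContDiff ℝ 1 (Function.uncurry E))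
    {w : (ι → ℝ) → ℝ} {S D : ℝ → (ι → ℝ) → ℝ}
    (hw : w = fun v => χ v * Real.exp (-(1/2 : ℝ) * (v ⬝ᵥ C⁻¹ *ᵥ v)))
    (hS : S = fun t v => -(t * (v ⬝ᵥ w₀)) + (P (t • a) v + (E (t • a) v - E₁)))
    (hD : D = fun t v => fderiv ℝ χ v (C *ᵥ w₀) / χ v
      + (fderiv ℝ (fun v' => P (t • a) v') v (C *ᵥ w₀) + fderiv ℝ (fun v' => E (t • a) v') v (C *ᵥ w₀))) (t : ℝ) :
    Integrable (fun v => D t v * gibbsWeight w S t v) := by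
  set H : (ι → ℝ) → ℝ := fun v => χ v * Real.exp (P (t • a) v + (E (t • a) v - E₁)) with hH
  have hHd : ContDiff ℝ 1 H := weight_contDiff hχ hP hE (t • a) E₁
  have hHs : HasCompactSupport H := hχs.mul_right
  have hc : Continuous fun v : ι → ℝ =>
      Real.exp (-(t * (v ⬝ᵥ w₀))) * fderiv ℝ H v (C *ᵥ w₀) * Real.exp (-(1/2 : ℝ) * (v ⬝ᵥ C⁻¹ *ᵥ v)) :=
    (((continuous_const.mul (continuous_id.dotProduct continuous_const)).neg.rexp.mul
      ((hHd.continuous_fderiv one_ne_zero).clm_apply continuous_const)).mul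
      (continuous_const.mul (continuous_id.dotProduct (continuous_const.matrix_mulVec continuous_id))).rexp)
  have hs : HasCompactSupport fun v : ι → ℝ =>
      Real.exp (-(t * (v ⬝ᵥ w₀))) * fderiv ℝ H v (C *ᵥ w₀) * Real.exp (-(1/2 : ℝ) * (v ⬝ᵥ C⁻¹ *ᵥ v)) := by
    have h1 : HasCompactSupport fun v : ι → ℝ => fderiv ℝ H v (C *ᵥ w₀) := by
      refine (hHs.fderiv (𝕜 := ℝ)).mono ?_
      intro v hv
      contrapose! hv
      simp [Function.notMem_support.1 hv]  -- fderiv H v = 0 ⇒ applied value = 0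
    exact (h1.mul_left).mul_right
  refine (hc.integrable_of_hasCompactSupport hs).congr (ae_of_all _ fun v => ?_)
  simp only [hH, hD]
  rw [fderiv_weight_apply hχ hP hE (t • a) E₁ v (C *ᵥ w₀), gibbsWeight_eq C w₀ a E₁ hw hS t v]
  linear_combination (-(Real.exp (-(t * (v ⬝ᵥ w₀))) * Real.exp (P (t • a) v + (E (t • a) v - E₁))
    * Real.exp (-(1/2 : ℝ) * (v ⬝ᵥ C⁻¹ *ᵥ v)))) * fderiv_div_mul_self hχ0 v (C *ᵥ w₀)

/-- **The per-`t` identity behind the second equality**: with `∂_tS_t = −⟨·,w₀⟩ + R_t` (`R_t` = the two chain-rule terms) and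
the second-form insert `G₂,t := −(∂_{Cw₀}χ/χ + ∂_{Cw₀}𝐏 + ∂_{Cw₀}𝐄) + R_t`:  `⟨∂_tS_t⟩_t = t⟨w₀,Cw₀⟩ + ⟨G₂,t⟩_t`.
[cite: Balaban1988Convergent, (3.28) p.272] -/
theorem gibbsExpect_S'_eq (hC : C.PosDef) (hχ : ContDiff ℝ 1 χ) (hχs : HasCompactSupport χ)
    (hχ0 : ∀ v, 0 ≤ χ v) (hχne : ∃ v, χ v ≠ 0) (hP : ContDiff ℝ 1 (Function.uncurry P))
    (hE : ContDiff ℝ 1 (Function.uncurry E)) {w : (ι → ℝ) → ℝ} {S S' D : ℝ → (ι → ℝ) → ℝ}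
    (hw : w = fun v => χ v * Real.exp (-(1/2 : ℝ) * (v ⬝ᵥ C⁻¹ *ᵥ v)))
    (hS : S = fun t v => -(t * (v ⬝ᵥ w₀)) + (P (t • a) v + (E (t • a) v - E₁)))
    (hS' : S' = fun t v => -(v ⬝ᵥ w₀) + (fderiv ℝ (fun a' => P a' v) (t • a) a + fderiv ℝ (fun a' => E a' v) (t • a) a))
    (hD : D = fun t v => fderiv ℝ χ v (C *ᵥ w₀) / χ v
      + (fderiv ℝ (fun v' => P (t • a) v') v (C *ᵥ w₀) + fderiv ℝ (fun v' => E (t • a) v') v (C *ᵥ w₀))) (t : ℝ) :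
    gibbsExpect volume w S (S' t) t
      = t * (w₀ ⬝ᵥ C *ᵥ w₀) + gibbsExpect volume w S (fun v => -(D t v)
          + (fderiv ℝ (fun a' => P a' v) (t • a) a + fderiv ℝ (fun a' => E a' v) (t • a) a)) t := by
  have hZ := (partFn_pos C w₀ a E₁ hχ hχs hχ0 hχne hP hE hw hS t).ne'
  -- integrability of the three inserts against the weight
  have iL : Integrable (fun v => -(v ⬝ᵥ w₀) * gibbsWeight w S t v) :=
    integrable_insert_mul_gibbsWeight C w₀ a E₁ hχ hχs hP hE hw hS t (continuous_id.dotProduct continuous_const).neg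
  have iR : Integrable (fun v =>
      (fderiv ℝ (fun a' => P a' v) (t • a) a + fderiv ℝ (fun a' => E a' v) (t • a) a) * gibbsWeight w S t v) :=
    integrable_insert_mul_gibbsWeight C w₀ a E₁ hχ hχs hP hE hw hS t
      (((continuous_fderiv_fst hP a a).add (continuous_fderiv_fst hE a a)).comp
        (continuous_const.prodMk continuous_id))
  have iD : Integrable (fun v => D t v * gibbsWeight w S t v) :=
    integrable_D_mul_gibbsWeight C w₀ a E₁ hχ hχs hχ0 hP hE hw hS hD t
  -- the un-normalised identity
  have hnum : gibbsNum volume w S (S' t) t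
      = t * (w₀ ⬝ᵥ C *ᵥ w₀) * partFn volume w S t + gibbsNum volume w S (fun v => -(D t v)
          + (fderiv ℝ (fun a' => P a' v) (t • a) a + fderiv ℝ (fun a' => E a' v) (t • a) a)) t := by
    have hsplit : gibbsNum volume w S (S' t) t
        = gibbsNum volume w S (fun v => -(v ⬝ᵥ w₀)) t + gibbsNum volume w S (fun v =>
            fderiv ℝ (fun a' => P a' v) (t • a) a + fderiv ℝ (fun a' => E a' v) (t • a) a) t := by
      simp only [gibbsNum, hS']
      rw [← integral_add iL iR]
      refine integral_congr_ae (ae_of_all _ fun v => ?_)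
      ring
    have iDn : Integrable (fun v => -(D t v * gibbsWeight w S t v)) := iD.neg
    have hsplit2 : gibbsNum volume w S (fun v => -(D t v)
          + (fderiv ℝ (fun a' => P a' v) (t • a) a + fderiv ℝ (fun a' => E a' v) (t • a) a)) t
        = -gibbsNum volume w S (D t) t + gibbsNum volume w S (fun v =>
            fderiv ℝ (fun a' => P a' v) (t • a) a + fderiv ℝ (fun a' => E a' v) (t • a) a) t := by
      simp only [gibbsNum]
      rw [← integral_neg, ← integral_add iDn iR]
      refine integral_congr_ae (ae_of_all _ fun v => ?_)
      ring
    rw [hsplit, hsplit2, gibbsNum_neg_dotProduct C w₀ a E₁ hC hχ hχs hχ0 hP hE hw hS hD t]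
    ring
  unfold gibbsExpect
  rw [hnum]
  field_simp

/-- **The cancellation**: integrating `gibbsExpect_S'_eq` over `t ∈ [0,1]` with r11's `eq328_half` (`∫₀¹ t·c dt = ½c`),
`∫₀¹ dt ⟨∂_tS_t⟩_t = ½⟨w₀,Cw₀⟩ + ∫₀¹ dt ⟨G₂,t⟩_t` — the `½⟨A_k, C*Δ^{(k)}CC^{(k)}(Λ_{k+1})C*Δ^{(k)}CA_k⟩` that removes the constant of
the first member. [cite: Balaban1988Convergent, (3.28) p.272] -/
theorem integral_gibbsExpect_S'_eq (hC : C.PosDef) (hχ : ContDiff ℝ 1 χ) (hχs : HasCompactSupport χ)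
    (hχ0 : ∀ v, 0 ≤ χ v) (hχne : ∃ v, χ v ≠ 0) (hP : ContDiff ℝ 1 (Function.uncurry P))
    (hE : ContDiff ℝ 1 (Function.uncurry E)) {w : (ι → ℝ) → ℝ} {S S' D : ℝ → (ι → ℝ) → ℝ}
    (hw : w = fun v => χ v * Real.exp (-(1/2 : ℝ) * (v ⬝ᵥ C⁻¹ *ᵥ v)))
    (hS : S = fun t v => -(t * (v ⬝ᵥ w₀)) + (P (t • a) v + (E (t • a) v - E₁)))
    (hS' : S' = fun t v => -(v ⬝ᵥ w₀) + (fderiv ℝ (fun a' => P a' v) (t • a) a + fderiv ℝ (fun a' => E a' v) (t • a) a))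
    (hD : D = fun t v => fderiv ℝ χ v (C *ᵥ w₀) / χ v
      + (fderiv ℝ (fun v' => P (t • a) v') v (C *ᵥ w₀) + fderiv ℝ (fun v' => E (t • a) v') v (C *ᵥ w₀))) :
    (∫ t in (0:ℝ)..1, gibbsExpect volume w S (S' t) t)
      = (1/2 : ℝ) * (w₀ ⬝ᵥ C *ᵥ w₀) + ∫ t in (0:ℝ)..1, gibbsExpect volume w S (fun v => -(D t v)
          + (fderiv ℝ (fun a' => P a' v) (t • a) a + fderiv ℝ (fun a' => E a' v) (t • a) a)) t := by
  have hpt : ∀ t, gibbsExpect volume w S (S' t) t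
      = t * (w₀ ⬝ᵥ C *ᵥ w₀) + gibbsExpect volume w S (fun v => -(D t v)
          + (fderiv ℝ (fun a' => P a' v) (t • a) a + fderiv ℝ (fun a' => E a' v) (t • a) a)) t :=
    fun t => gibbsExpect_S'_eq C w₀ a E₁ hC hχ hχs hχ0 hχne hP hE hw hS hS' hD t
  have hI := intervalIntegrable_gibbsExpect_S' C w₀ a E₁ hχ hχs hχ0 hχne hP hE hw hS hS'
  have hlin : IntervalIntegrable (fun t : ℝ => t * (w₀ ⬝ᵥ C *ᵥ w₀)) volume 0 1 :=
    (continuous_id.mul continuous_const).intervalIntegrable _ _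
  have hG : IntervalIntegrable (fun t => gibbsExpect volume w S (fun v => -(D t v)
      + (fderiv ℝ (fun a' => P a' v) (t • a) a + fderiv ℝ (fun a' => E a' v) (t • a) a)) t) volume 0 1 := by
    refine (hI.sub hlin).congr fun t _ => ?_  -- = ⟨∂_tS_t⟩_t − t·c
    simp only [hpt t]; ring
  rw [intervalIntegral.integral_congr (fun t _ => hpt t), intervalIntegral.integral_add hlin hG, eq328_half]

/-- **(3.28), THE SECOND PRINTED EQUALITY, for genuine Gaussian integrals**: the first member equals
`∫₀¹ dt ⟨−⟨Cw₀, (δ/δA)χ/χ + (δ/δA)𝐏(tA_k,A) + (δ/δA)𝐄(tA_k,A)⟩ + ⟨(δ/δtA_k)𝐏(tA_k,A), A_k⟩ + ⟨(δ/δtA_k)𝐄(tA_k,A), A_k⟩⟩_t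
   + log[∫ χ exp[𝐏(0,A) + {𝐄(0,A) − 𝐄₁}] dμ_C]`
— the constant `−½⟨w₀,Cw₀⟩` is gone (Gaussian integration by parts + `∫₀¹ t dt = ½`).  `⟨A_k, C*Δ^{(k)}C C^{(k)}(Λ_{k+1})(δ/δA)F⟩ =
⟨Cw₀, ∇F⟩ = fderiv F v (C *ᵥ w₀)`. [cite: Balaban1988Convergent, (3.28) p.272] [cite: GlimmJaffe1987, §9.1 (9.1.32)] -/
theorem eq328_second (hC : C.PosDef) (hχ : ContDiff ℝ 1 χ) (hχs : HasCompactSupport χ) (hχ0 : ∀ v, 0 ≤ χ v)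
    (hχne : ∃ v, χ v ≠ 0) (hP : ContDiff ℝ 1 (Function.uncurry P)) (hE : ContDiff ℝ 1 (Function.uncurry E))
    {w : (ι → ℝ) → ℝ} {S S' D : ℝ → (ι → ℝ) → ℝ}
    (hw : w = fun v => χ v * Real.exp (-(1/2 : ℝ) * (v ⬝ᵥ C⁻¹ *ᵥ v)))
    (hS : S = fun t v => -(t * (v ⬝ᵥ w₀)) + (P (t • a) v + (E (t • a) v - E₁)))
    (hS' : S' = fun t v => -(v ⬝ᵥ w₀) + (fderiv ℝ (fun a' => P a' v) (t • a) a + fderiv ℝ (fun a' => E a' v) (t • a) a))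
    (hD : D = fun t v => fderiv ℝ χ v (C *ᵥ w₀) / χ v
      + (fderiv ℝ (fun v' => P (t • a) v') v (C *ᵥ w₀) + fderiv ℝ (fun v' => E (t • a) v') v (C *ᵥ w₀))) :
    (∫ t in (0:ℝ)..1, gibbsExpect volume w S (S' t) t) - (1/2 : ℝ) * (w₀ ⬝ᵥ C *ᵥ w₀)
        + Real.log (∫ v : ι → ℝ, χ v * Real.exp (P 0 v + (E 0 v - E₁)) * Real.exp (-(1/2 : ℝ) * (v ⬝ᵥ C⁻¹ *ᵥ v)))
      = (∫ t in (0:ℝ)..1, gibbsExpect volume w S (fun v => -(D t v)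
          + (fderiv ℝ (fun a' => P a' v) (t • a) a + fderiv ℝ (fun a' => E a' v) (t • a) a)) t)
        + Real.log (∫ v : ι → ℝ, χ v * Real.exp (P 0 v + (E 0 v - E₁)) * Real.exp (-(1/2 : ℝ) * (v ⬝ᵥ C⁻¹ *ᵥ v))) := by
  rw [integral_gibbsExpect_S'_eq C w₀ a E₁ hC hχ hχs hχ0 hχne hP hE hw hS hS' hD]
  ring

/-- **(3.28) pp. 271–272 END TO END, BOTH EQUALITIES, every insert written out as printed** (`w₀ = C*Δ^{(k)}CA_k`, `dμ_C(v) ∝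
e^{−½vᵀC⁻¹v}dv`; `⟨·⟩_t` = `gibbsExpect` of the (3.29) weight, whose normalised law is `gibbsLaw volume w S t`, §5):
  `log ∫ χ exp[−⟨v,w₀⟩ − ½⟨w₀,Cw₀⟩ + 𝐏(a,v) + {𝐄(a,v) − 𝐄₁}] dμ_C`
  `= ∫₀¹ dt ⟨−⟨v,w₀⟩ + D₁𝐏(t•a,v)·a + D₁𝐄(t•a,v)·a⟩_t − ½⟨w₀,Cw₀⟩ + log ∫ χ exp[𝐏(0,v) + {𝐄(0,v) − 𝐄₁}] dμ_C`
  `= ∫₀¹ dt ⟨−(∂_{Cw₀}χ/χ + ∂_{Cw₀}𝐏(t•a,·) + ∂_{Cw₀}𝐄(t•a,·))(v) + D₁𝐏(t•a,v)·a + D₁𝐄(t•a,v)·a⟩_t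
       + log ∫ χ exp[𝐏(0,v) + {𝐄(0,v) − 𝐄₁}] dμ_C`.
[cite: Balaban1988Convergent, (3.28)–(3.29) pp.271–272] [cite: GlimmJaffe1987, §9.1 (9.1.27), (9.1.28), (9.1.32)] -/
theorem eq328 (hC : C.PosDef) (hχ : ContDiff ℝ 1 χ) (hχs : HasCompactSupport χ) (hχ0 : ∀ v, 0 ≤ χ v)
    (hχne : ∃ v, χ v ≠ 0) (hP : ContDiff ℝ 1 (Function.uncurry P)) (hE : ContDiff ℝ 1 (Function.uncurry E))
    {w : (ι → ℝ) → ℝ} {S : ℝ → (ι → ℝ) → ℝ}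
    (hw : w = fun v => χ v * Real.exp (-(1/2 : ℝ) * (v ⬝ᵥ C⁻¹ *ᵥ v)))
    (hS : S = fun t v => -(t * (v ⬝ᵥ w₀)) + (P (t • a) v + (E (t • a) v - E₁))) :
    Real.log (∫ v : ι → ℝ, χ v * Real.exp (-(v ⬝ᵥ w₀) - (1/2 : ℝ) * (w₀ ⬝ᵥ C *ᵥ w₀) + (P a v + (E a v - E₁)))
        * Real.exp (-(1/2 : ℝ) * (v ⬝ᵥ C⁻¹ *ᵥ v)))
      = (∫ t in (0:ℝ)..1, gibbsExpect volume w S (fun v => -(v ⬝ᵥ w₀)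
          + (fderiv ℝ (fun a' => P a' v) (t • a) a + fderiv ℝ (fun a' => E a' v) (t • a) a)) t)
        - (1/2 : ℝ) * (w₀ ⬝ᵥ C *ᵥ w₀)
        + Real.log (∫ v : ι → ℝ, χ v * Real.exp (P 0 v + (E 0 v - E₁)) * Real.exp (-(1/2 : ℝ) * (v ⬝ᵥ C⁻¹ *ᵥ v)))
    ∧ (∫ t in (0:ℝ)..1, gibbsExpect volume w S (fun v => -(v ⬝ᵥ w₀)
          + (fderiv ℝ (fun a' => P a' v) (t • a) a + fderiv ℝ (fun a' => E a' v) (t • a) a)) t)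
        - (1/2 : ℝ) * (w₀ ⬝ᵥ C *ᵥ w₀)
        + Real.log (∫ v : ι → ℝ, χ v * Real.exp (P 0 v + (E 0 v - E₁)) * Real.exp (-(1/2 : ℝ) * (v ⬝ᵥ C⁻¹ *ᵥ v)))
      = (∫ t in (0:ℝ)..1, gibbsExpect volume w S (fun v =>
          -(fderiv ℝ χ v (C *ᵥ w₀) / χ v
            + (fderiv ℝ (fun v' => P (t • a) v') v (C *ᵥ w₀) + fderiv ℝ (fun v' => E (t • a) v') v (C *ᵥ w₀)))
          + (fderiv ℝ (fun a' => P a' v) (t • a) a + fderiv ℝ (fun a' => E a' v) (t • a) a)) t)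
        + Real.log (∫ v : ι → ℝ, χ v * Real.exp (P 0 v + (E 0 v - E₁)) * Real.exp (-(1/2 : ℝ) * (v ⬝ᵥ C⁻¹ *ᵥ v))) := by
  set S' : ℝ → (ι → ℝ) → ℝ := fun t v =>
    -(v ⬝ᵥ w₀) + (fderiv ℝ (fun a' => P a' v) (t • a) a + fderiv ℝ (fun a' => E a' v) (t • a) a) with hS'
  set D : ℝ → (ι → ℝ) → ℝ := fun t v => fderiv ℝ χ v (C *ᵥ w₀) / χ v
    + (fderiv ℝ (fun v' => P (t • a) v') v (C *ᵥ w₀) + fderiv ℝ (fun v' => E (t • a) v') v (C *ᵥ w₀)) with hD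
  exact ⟨eq328_first C w₀ a E₁ hχ hχs hχ0 hχne hP hE hw hS hS',
    eq328_second C w₀ a E₁ hC hχ hχs hχ0 hχne hP hE hw hS hS' hD⟩


/-! ## §5  (3.29): the probabilistic measure `Z_t⁻¹ dμ_C χ exp[…]` is a probability measure and `⟨·⟩_t` is its expectation -/
/-- **(3.29) p. 272: the tilted law `Z_t⁻¹·(w e^{S_t}) dv` IS A PROBABILITY MEASURE for every `t`** (*"the probabilistic
measure Z_t^{−1} dμ_{C^{(k)}(Λ_{k+1})}(A) χ^{(k)} exp[…]"*). [cite: Balaban1988Convergent, (3.29) p.272] -/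
theorem isProbabilityMeasure_gibbsLaw (hχ : ContDiff ℝ 1 χ) (hχs : HasCompactSupport χ) (hχ0 : ∀ v, 0 ≤ χ v)
    (hχne : ∃ v, χ v ≠ 0) (hP : ContDiff ℝ 1 (Function.uncurry P)) (hE : ContDiff ℝ 1 (Function.uncurry E))
    {w : (ι → ℝ) → ℝ} {S : ℝ → (ι → ℝ) → ℝ}
    (hw : w = fun v => χ v * Real.exp (-(1/2 : ℝ) * (v ⬝ᵥ C⁻¹ *ᵥ v)))
    (hS : S = fun t v => -(t * (v ⬝ᵥ w₀)) + (P (t • a) v + (E (t • a) v - E₁))) (t : ℝ) :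
    IsProbabilityMeasure (gibbsLaw volume w S t) := by
  have hZ := partFn_pos C w₀ a E₁ hχ hχs hχ0 hχne hP hE hw hS t
  have hint : Integrable (gibbsWeight w S t) :=
    (continuous_gibbsWeight C w₀ a E₁ hχ hP hE hw hS t).integrable_of_hasCompactSupport
      (hasCompactSupport_gibbsWeight C hχs S hw t)
  refine ⟨?_⟩
  rw [gibbsLaw, Measure.smul_apply, smul_eq_mul, withDensity_apply _ MeasurableSet.univ, Measure.restrict_univ,
    ← ofReal_integral_eq_lintegral_ofReal hint (ae_of_all _ fun v => gibbsWeight_nonneg' C hχ0 S hw t v)]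
  exact ENNReal.inv_mul_cancel (ENNReal.ofReal_pos.2 hZ).ne' ENNReal.ofReal_ne_top

/-- **(3.29) p. 272: `⟨G⟩_t` IS the expectation against the tilted law**: `∫ G d(gibbsLaw_t) = gibbsExpect volume w S G t`
(*"⟨·⟩_t denotes the expectation value with respect to the probabilistic measure …"*). [cite: Balaban1988Convergent, (3.29) p.272] -/
theorem integral_gibbsLaw (hχ : ContDiff ℝ 1 χ) (hχs : HasCompactSupport χ) (hχ0 : ∀ v, 0 ≤ χ v)
    (hχne : ∃ v, χ v ≠ 0) (hP : ContDiff ℝ 1 (Function.uncurry P)) (hE : ContDiff ℝ 1 (Function.uncurry E))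
    {w : (ι → ℝ) → ℝ} {S : ℝ → (ι → ℝ) → ℝ}
    (hw : w = fun v => χ v * Real.exp (-(1/2 : ℝ) * (v ⬝ᵥ C⁻¹ *ᵥ v)))
    (hS : S = fun t v => -(t * (v ⬝ᵥ w₀)) + (P (t • a) v + (E (t • a) v - E₁))) (t : ℝ) (G : (ι → ℝ) → ℝ) :
    ∫ v, G v ∂(gibbsLaw volume w S t) = gibbsExpect volume w S G t := by
  have hZ := partFn_pos C w₀ a E₁ hχ hχs hχ0 hχne hP hE hw hS t
  rw [gibbsLaw, MeasureTheory.integral_smul_measure, integral_withDensity_eq_integral_toReal_smul₀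
    (show AEMeasurable (fun v => ENNReal.ofReal (gibbsWeight w S t v)) volume from
      ENNReal.measurable_ofReal.comp_aemeasurable
        (continuous_gibbsWeight C w₀ a E₁ hχ hP hE hw hS t).aestronglyMeasurable.aemeasurable)
    (ae_of_all _ fun _ => ENNReal.ofReal_lt_top),
    ENNReal.toReal_inv, ENNReal.toReal_ofReal hZ.le, gibbsExpect, gibbsNum, div_eq_inv_mul, smul_eq_mul]
  congr 1
  refine integral_congr_ae (ae_of_all _ fun v => ?_)
  dsimp only
  rw [ENNReal.toReal_ofReal (gibbsWeight_nonneg' C hχ0 S hw t v), smul_eq_mul, mul_comm]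

end Family

end Literature.MathematicalPhysics.QuantumFieldTheory.Balaban1983to89.B14.Eq328Printed

end
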